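import Summits.QuantumFields.YangMills.Theorems.BalabanUVNodesN12AtRecord13Prop1KnitThm1OfRecord
import Literature.MathematicalPhysics.QuantumFieldTheory.Balaban1983to89.B15Prop1ClosedGuardUniformRadius
import Literature.MathematicalPhysics.QuantumFieldTheory.Balaban1983to89.Node00.Record13NumericsOfThm1CCMW

/-!
# BalabanUVNodes ∕ N12 — N12's PROPOSITION-1 ROW AT THE RECORD IN THE COMPACTNESS ROUTE's CURRENCY: 12Q⁵ `…N12AtRecord13Prop1KnitThm1OfRecord` §1–§2 RE-KEYED on dag-n12-c g17's
# `B15Prop1ClosedGuardUniformRadius` §4 (p60xxxx ✓ 03:21Z 2026-08-28) — the intrinsic configuration letter (J0′) in the SHAPE THE w-LINEAGE DELIVERS («for every compact set of base fields inside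
# the CLOSED small-field guard, ONE radius»), the (L2) letter ONE-SIDED and γ₀-generic, the radius `R` PRODUCED (no `hR`), the current constant `cJ`∕`hcJ'` ABSORBED under a FINITE instance index
# per run; §2 at the GENERIC WINDOW-EDITION WITNESS `θ₁₅ᶜᶜᴹᵂ(j;γ;ε₀,ε₂₉;B₃,B₃',a₀,a₁)` of plan g81 K0⁷ V19 ∕ dag-n24-c's door, where the [15]-Theorem-1 input of the row IS the door letter `h15`
# (Track A, DAG node N12 = [B15, Balaban1989LargeFieldI] CMP **122** (1989) 175–202; cluster K1 — K1⁷ `StabilityBAtRecordR13SepCoPH` = stmt-QuantumFields-20542, helper; seat `pub-ymgap-dag-n12-d`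
# g16 (R134 s2 «knit at the record»), 2026-08-28; count-neutral, CONDITIONAL, NOT a discharge)

HONEST FRAMING.  Count-neutral kernel bookkeeping BY NAME over landed modules: this seat's 12Q⁵ (p56xxxx; §0 junction `thm1TorusClass_of_variationalThm1RegSepCoP7M` — NODE 00's (8) read at the
degenerate history IS dag-n12-c's torus-class [15] letter —, §1∕§2's statement shapes), dag-n12-c g17's ★★★ `…_ofThm1TorusClass_ofMinimiserFamilyCompact_oneSided` (point-set topology + bookkeeping
around dag-n12-w1's one-sided endpoint p589595: the closed guard is compact, so the compact-uniform (J0′) letter serves; `cJ := max_i (…)` over the finite index), 12E's row, K0a's witnesses.  WHAT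
CHANGES relative to 12Q⁵ (binders only; no new mathematics): (J1) `hGj` (a joint holomorphic extension with a NAMED radius `R i`) ↦ (J0′) `hMinC` (per run and instance: every COMPACT `Kc` of base
fields inside the closed guard gets ONE radius with the three clauses — holomorphic bond-matrix family on the sup-ball, bounded by `𝓐₀`, equal at real points to a (2.12) minimiser; the output shape of
dag-n12-w1's `B15Prop1MinimiserFamilyPatching.hMin_of_localCharts` ∕ `B15Prop1CriticalChartFromIFT.hMin_of_criticalFamilies` lineage); (L2) `hlead` (two-sided, `(4∕π²)^{d+2}`, `formDk` comparison,
`n'`) ↦ `h17` (ONE-SIDED (1.7) with the curl form, γ₀-generic) + `hsm`∕`hγle` in γ₀; `hR`, `h𝓐`, `n'`, `hn'`, `hcJ`, `hcJ'` GONE; `[∀ P, Finite (ι P)]` ADDED (the price of the existential radius: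
print's radius is explicit, (1.13) p. 359 — dag-n12-c's located note); the conclusion PRODUCES the radii `R P i` together with the regularity thresholds `areg P i`, and the analyticity clause's
width reads `card Plaq · (1 + 8𝓐₀⁴)` (dag-n12-w1's bound) in place of `𝓐`.  §2: the witness is the GENERIC window-edition `θ₁₅ᶜᶜᴹᵂ(j;γ;…)` (12Q⁵ §2 sat at the collared `θ₁₅ᶜᶜᴹ(jM)`; the window
edition's Stage-7 numerics ARE the collared member's, `rfl` — `M₁ = L^j`, `εreg = a₀`), and the [15] input is dag-n24-c's DOOR LETTER `h15 : VariationalThm1RegSepCoP7M F 2 B₃ a₀ a₁` itself (12Q⁵ §2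
derived it from V15 stub 1's Prop-8 step; on V19's road the door carries it), with the door's sign `hB : 0 ≤ B₃` and the cube letter POSITIVE, `1 ≤ j` (print's `M₁ ≥ 2`; the V19 cube letter is
`j = ρ₀ + 3` — LOCATED: a Prop-1 row at `j = 0` is not served by this road).  WHAT STAYS A LETTER per run ∕ instance: (J0′) `hMinC` (dag-n12-w1…w4's analytic lane), (L2) `h17` + `hsm`∕`hγle`
(NODE 00 ∕ [LF-II] pp.357–359), (Gᵃ) `hZblk`, `hM2` (generic `Θ`) + `hdiv`, the box inclusion `hZ1`, `hk0`∕`hk`, box data, `[Finite (ι P)]`; K0b's residuals `hres` (generic `Θ`); N12's per-run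
displays below the torus ((1.100) pin, live-mass — NODE 00 —, (1.80), (1.89)); and (8) ∕ `h15` — a HYPOTHESIS (K0⁷'s ∕ the door's), never asserted.  Nothing of Bałaban's is asserted; N12 is NOT
discharged; no node is discharged; K0⁷ ∕ K1⁷ NOT closed; counts unmoved (discharged 5∕27 · Track A 5∕28).  TYPING NOTE: as in 12Q⁵ — hypothesis bodies at the AMBIENT bond decidability,
dag-n12-c's endpoint taking `[hdec]` with `hcl := Subsingleton.elim _ _`; `IsBlockUnion` ∕ `blockIter` ∕ `side` written `B14.…`; Node00 names unqualified under `open … Node00`.  ONE finite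
four-torus programme at fixed `ε = L^{-K}` — nothing continuum ∕ ℝ⁴ ∕ OS ∕ mass gap ∕ Clay.  No `sorry`, `def`, `instance`, `notation`.

Sources: [Balaban1989LargeFieldI] (0.2)–(0.6) p.176, (1.74) p.192, p.193 ll.14–20, Prop. 1 (1.77)–(1.78) p.194, (1.79)–(1.80) p.195, (1.89) p.198, (1.99)–(1.102) pp.200–201; [Balaban1989LargeFieldII]
(1.7)–(1.9) p.358, (1.11)–(1.13) p.359; [Balaban1988Convergent] (2.1) p.254, (2.5) p.255, (2.12)–(2.14) pp.256–257, (2.18) p.257, (3.16) p.268, (3.22)–(3.25) pp.269–270; [Balaban1985Variational]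
(1) p.277, (7) p.278, Thm 1 (8)–(9) p.279, Prop. 9 (190) p.309; [Balaban1985RegularSpaces] (1.3)–(1.9) p.77; [Balaban1987RG1] Thm 1 p.259 (bookkeeping).
-/

noncomputable section
open MeasureTheory Set Finset Metric
open scoped Matrix.Norms.L2Operator BigOperators Matrix RealInnerProductSpace Real InnerProductSpace

namespace Summit.QuantumFields.YangMills.BalabanUVNodes.N12AtRecord13Prop1KnitThm1CompactOfRecord

open Literature.MathematicalPhysics.QuantumFieldTheory.Balaban1983to89
open Literature.MathematicalPhysics.QuantumFieldTheory.Balaban1983to89.T4Continuum (T4Family)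
open Literature.MathematicalPhysics.QuantumFieldTheory.Balaban1983to89.DagBinding
open Literature.MathematicalPhysics.QuantumFieldTheory.Balaban1983to89.Node00
open B15Claim189Assembly (new189 chiPP dom)
open B15 (Prop1Printed Ineq180)
open B15.BasicStep (Claim189)
open B8Eq17ClassAkV1 (plaqsOf)
open B15RPrime1100OfRep (rPrimeDataOfSel)
open Summit.QuantumFields.YangMills.BalabanUVNodes.N12AtRecord13OfResiduals (b15Leaf_WOfRecord₁₃_liveRepin₁₃_of_massLive_of_hasResiduals)
open Summit.QuantumFields.YangMills.BalabanUVNodes.N12AtRecord13Prop1KnitThm1OfRecord (thm1TorusClass_of_variationalThm1RegSepCoP7M)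
-- dag-n12-c's vocabulary (as opened in 12Q⁵ ∕ `B15Prop1ClosedGuardUniformRadius`)
open B15DeterminingSets (pts DetBackground genSet IsMinimizer MSField avgFamily)
open B15Prop1Carrier (lfVarOn InstOn InstOn.std plaqsInside)
open B15Prop1ClosedGuardUniformRadius (exists_domain_prop1Printed_lfVarOn_std_su2_box_intrinsic_analytic_atZSeqCoPRecord_ofThm1TorusClass_ofMinimiserFamilyCompact_oneSided)
open B15Prop1GradientFromNearValueAtCoPRecord (far_letter_of_box)
open B15Prop1AnalyticExtClause (cplxVec anExt)
open B15Prop1ChartCalculusSU2 (E3)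
open T4CubeChartGnomonic (SU2)
open B15Prop1ChartSU2 (su2Chart)
open B15Prop1SliceCoordinates (GaugeSlice ιA)
open B15Prop1SliceTaylorCalculus (rGrad sliceFn)
open T4AxialGaugeSmallField (castSite boxPlaqs)
open B6BondElimination (unitVec)
open B6TreeGaugePoincare (curl)
open B16Eq18Proof (box)
open B15Extension193 (extend)
open B15ShellGauge193 (shellGauge)
open B15Sect1Instances (fun177std)
open B14.Eq213DetSet (Bj maxDomT)
open Literature.MathematicalPhysics.QuantumFieldTheory.BalabanImbrieJaffe1984to88.BIJ85Eq453GaugeField (qsstarGIter0)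
open B16Sect1Backgrounds (expMul)
open GaugeGroup (dist1)

variable {F : T4Family}

/-! ## §1 `N = 2`, generic `Θ` carrying node00-def-K0b's residuals: 12Q⁵ §1 with (J0′) in the compactness route's shape, `R` PRODUCED, `cJ` ABSORBED -/

section RecordAtZSeqCompact
variable (Θ : Stage13Params F 2) (lam : ResidW F 2)

/-- **★★★★ N12's ROW BELOW THE TORUS AT THE LIVE RE-PIN, `N = 2`, AT PRINT's (1.74) OBJECT, (J0′) IN THE COMPACTNESS ROUTE's SHAPE, THE RADIUS PRODUCED** — 12Q⁵ §1
(`exists_pinLF_b15Leaf_WOfRecord₁₃_liveRepin₁₃_of_massLive_of_hasResiduals_of_variationalThm1RegSepCoP7M_atZSeqCoPRecord_geom`) with dag-n12-c g15's endpoint `…_ofThm1TorusClass` replaced by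
dag-n12-c g17's `…_ofThm1TorusClass_ofMinimiserFamilyCompact_oneSided`, run by run: per run `P` and instance `i : ι P` the configuration letter is (J0′) `hMinC` (for every compact `Kc` inside the
closed guard, ONE radius with the three clauses), the Hessian letter is the ONE-SIDED (1.7) `h17` (+ `hsm`∕`hγle`, γ₀-generic), the instance index is FINITE, and the conclusion PRODUCES the radii
`R P i` and the thresholds `areg P i` at which the pinned LF layer's leaf holds; the [15] input is NODE 00's named fact `h15 : VariationalThm1RegSepCoP7M F 2 B₃ a₀ a₁'`, read by 12Q⁵ §0's junction at
the degenerate history as dag-n12-c's torus-class letter `h15T` at every `(Θ.ν, P.K)`; `hfar` from the box-inclusion letter `hZ1` by dag-n12-c's `far_letter_of_box`; then 12E's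
`b15Leaf_WOfRecord₁₃_liveRepin₁₃_of_massLive_of_hasResiduals`.  WHAT STAYS A LETTER: (J0′) `hMinC`, (L2) `h17` + `hsm` ∕ `hγle`, (Gᵃ) `hZblk`, `hM2` + `hdiv`, `hZ1`, `hk0` ∕ `hk`, box data,
`[Finite (ι P)]`; K0b's residuals `hres`; N12's per-run displays below the torus ((1.100) pin, live-mass, (1.80), (1.89)); AND (8) itself — a HYPOTHESIS (K0⁷'s), never asserted.  GONE relative to
12Q⁵ §1: `hR`, `h𝓐`, `n'`, `hn'`, `hcJ`, `hcJ'`.  Count-neutral; NOT a discharge of N12. [cite: Balaban1989LargeFieldI, (0.2)–(0.6) p.176, (1.74) p.192, p.193 ll.14–20, Prop. 1 (1.77)–(1.78) p.194, (1.79)–(1.80) p.195, (1.89) p.198, (1.99)–(1.102) pp.200–201; Balaban1989LargeFieldII, (1.7)–(1.9) p.358, (1.11)–(1.13) p.359; Balaban1988Convergent, (2.1) p.254, (2.5) p.255, (2.12)–(2.14) pp.256–257, (2.18) p.257, (3.16) p.268, (3.22)–(3.25) pp.269–270; Balaban1985Variational, (1) p.277, (7) p.278, Thm 1 (8) p.279,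 Prop. 9 (190) p.309; Balaban1985RegularSpaces, (1.3)–(1.9) p.77 (bookkeeping)] -/
theorem exists_radius_pinLF_b15Leaf_WOfRecord₁₃_liveRepin₁₃_of_massLive_of_hasResiduals_of_variationalThm1RegSepCoP7M_atZSeqCoPRecord_compact (hres : Θ.HasResidualsOfRecord F 2)
    -- N12's displays at the letters `kSel ∕ D189 ∕ D1100` of `λ`, run by run, BELOW THE TORUS
    (hpin : ∀ P : B12.RunParams, lam.kSel P < P.K → lam.D1100 P
      = rPrimeDataOfSel (reprTOfRecord₁₃ F 2 (Θ.liveRepin₁₃ F 2) P (lam.kSel P))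
          ((Θ.liveRepin₁₃ F 2).ppSel P (gOfRecord₁₃ F 2 (Θ.liveRepin₁₃ F 2) P) (lam.kSel P + 1))
          (fibOfSeq F (Θ.liveRepin₁₃ F 2).ν (Θ.liveRepin₁₃ F 2).τ9 P (gOfRecord₁₃ F 2 (Θ.liveRepin₁₃ F 2) P) (lam.kSel P + 1)))
    (hmassLive : ∀ P : B12.RunParams, lam.kSel P < P.K → ∀ s, LiveSeq F 2 Θ.ν Θ.τ9 P (gOfRecord₁₃ F 2 (Θ.liveRepin₁₃ F 2) P) (lam.kSel P + 1)
        (slotsTOfRecord F 2 Θ.ν Θ.τ9 (EOfRecord₁₃ F 2 (Θ.liveRepin₁₃ F 2)) (wOfRecord₉ F 2 (Θ.liveRepin₁₃ F 2).toStage9Params)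
          (Θ.liveRepin₁₃ F 2).ppSel P (gOfRecord₁₃ F 2 (Θ.liveRepin₁₃ F 2) P) (lam.kSel P + 1)) s →
      0 < ∫ V, rterm (reprTOfRecord₁₃ F 2 (Θ.liveRepin₁₃ F 2) P (lam.kSel P)) s V ∂(fieldMeasure (F.P P.K) (lam.kSel P + 1) (SU 2)))
    (h180 : ∀ P : B12.RunParams, lam.kSel P < P.K → ∀ U, new189 (lam.D189 P) U → ∀ i, (lam.D189 P).h ≤ i → i ≤ (lam.D189 P).k →
      ∀ q ∈ plaqsOf (dom (lam.D189 P) i),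
        Ineq180 ((lam.D189 P).dev0 U q) ((lam.D189 P).ε (lam.D189 P).k) (lam.D189 P).η (lam.D189 P).B₃ (lam.D189 P).B₅ (lam.D189 P).M (lam.D189 P).δ
          ((lam.D189 P).dist q) (lam.D189 P).O1)
    (h189 : ∀ P : B12.RunParams, lam.kSel P < P.K → Claim189 (new189 (lam.D189 P)) (chiPP (lam.D189 P)))
    -- dag-n12-c's Proposition-1 instance data ON THE RUN's LATTICE `F.P P.K`, per run `P` and instance `i : ι P` (structural ∕ constants, exactly as in its endpoint of record)
    (hd3 : ∀ P : B12.RunParams, 3 ≤ (F.P P.K).d) (h0 : ∀ P : B12.RunParams, 0 < (F.P P.K).d) (ι : B12.RunParams → Type)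
    -- the instance index of EVERY run is FINITE (dag-n12-c g17: on one finite lattice the instances `(Z, Λ^{(k)}, k, M)` of [IV] Prop. 1 form a finite set — the price of the
    -- compactness route's existential radius; print's radius is explicit, (1.13) p. 359)
    [hfin : ∀ P : B12.RunParams, Finite (ι P)]
    -- NO background letters: per instance the class is that of `Z P i`'s OWN maximal sequence `maxDomT Θ.ν.M₁ (Z P i)` up to scale `k P i` (dag-n12-c LOCATED-CLASS)
    (Z Λ : ∀ P : B12.RunParams, ι P → Set (Site (F.P P.K) 0))
    (k : ∀ P : B12.RunParams, ι P → ℕ) (M : ∀ P : B12.RunParams, ι P → ℝ) (hk0 : ∀ P i, 0 < k P i) (hk : ∀ P i, k P i ≤ (F.P P.K).m + (F.P P.K).K)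
    (eR : ∀ P : B12.RunParams, ι P → ℝ) (heR : ∀ P i, 0 < eR P i)
    (T : ∀ (P : B12.RunParams) (i : ι P), Finset (PBond (F.P P.K) (k P i)))
    (lo hi : ∀ P : B12.RunParams, ι P → Fin (F.P P.K).d → ℤ) (n : ∀ P : B12.RunParams, ι P → ℕ) (hn : ∀ P i κ, hi P i κ ≤ lo P i κ + n P i)
    (hN : ∀ P i, n P i + 2 < (F.P P.K).sitesPerDir (k P i))
    (hbox : ∀ P i, pts (k P i) (Λ P i) = (castSite '' Set.Icc (lo P i) (hi P i) : Set (Site (F.P P.K) (k P i))))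
    (hZ : ∀ P i, (boxPlaqs (lo P i - 1) (hi P i + 1) : Set (Plaq (F.P P.K) (k P i))) ⊆ plaqsInside (pts (k P i) (Z P i)))
    (hTG0 : ∀ P i, T P i = (box (fun κ => (hi P i κ - lo P i κ + 1).toNat) (lo P i)).image fun x =>
      (⟨castSite (x - unitVec ⟨0, h0 P⟩), ⟨0, h0 P⟩⟩ : PBond (F.P P.K) (k P i)))
    (hN5 : ∀ P i κ, ((hi P i κ - lo P i κ + 1).toNat : ℤ) + 5 < (F.P P.K).sitesPerDir (k P i))
    (Kb : ∀ P : B12.RunParams, ι P → ℕ) (hK1 : ∀ P i, 1 ≤ Kb P i) (hKn : ∀ P i κ, (hi P i κ - lo P i κ + 1).toNat ≤ Kb P i)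
    (ext : ∀ (P : B12.RunParams) (i : ι P), GaugeField (F.P P.K) (k P i) SU2 → GaugeField (F.P P.K) (k P i) SU2)
    (hext : ∀ P i Vk, ext P i Vk = extend (pts (k P i) (Λ P i)) (shellGauge Vk (lo P i) (hi P i)) Vk)
    (hlohi : ∀ P i, lo P i ≤ hi P i)
    {γ bx : B12.RunParams → ℝ} (hγ : ∀ P, 0 < γ P) (hbx : ∀ P, 0 ≤ bx P)
    (hbxM : ∀ P i, 12 * ((F.P P.K).d : ℝ) * ((n P i : ℝ) + 2) ^ 2 ≤ bx P * (M P i) ^ 2)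
    {Cerr 𝓐₀ : ∀ P : B12.RunParams, ι P → ℝ} (hM : ∀ P i, 1 ≤ M P i)
    {γ₀ : B12.RunParams → ℝ} (hγ₀ : ∀ P, 0 ≤ γ₀ P)
    -- (J0′) THE INTRINSIC CONFIGURATION LETTER IN THE COMPACTNESS ROUTE's OUTPUT SHAPE (dag-n12-c g17 §4 `hMinC`; produced by dag-n12-w1's `hMin_of_localCharts` ∕ `hMin_of_criticalFamilies`
    -- lineage at `Kc :=` the closed guard): per run and instance, for EVERY COMPACT SET `Kc` of base fields inside the CLOSED small-field guard, ONE radius `R > 0` with the three clauses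
    (hMinC : ∀ P i (Kc : Set (GaugeField (F.P P.K) (k P i) SU2)), IsCompact Kc →
      (∀ Vk ∈ Kc, ∀ p ∈ plaqsInside (pts (k P i) (Z P i ∩ (Λ P i)ᶜ)), dist1 (GaugeField.plaqHol Vk p) ≤ eR P i) →
      ∃ R : ℝ, 0 < R ∧ ∀ Vk ∈ Kc,
      ∃ Ũ : VecField (F.P P.K) (k P i) (EuclideanSpace ℂ (Fin 3)) × VecField (F.P P.K) (k P i) (EuclideanSpace ℂ (Fin 3)) →
          PBond (F.P P.K) 0 → Matrix (Fin 2) (Fin 2) ℂ,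
        (∀ b a c, DifferentiableOn ℂ (fun z => Ũ z b a c) (ball 0 R)) ∧
        (∀ z ∈ ball (0 : VecField (F.P P.K) (k P i) (EuclideanSpace ℂ (Fin 3)) × VecField (F.P P.K) (k P i) (EuclideanSpace ℂ (Fin 3))) R,
          ∀ b a c, ‖Ũ z b a c‖ ≤ 𝓐₀ P i) ∧
        ∀ p B' : VecField (F.P P.K) (k P i) E3, ‖p‖ < R → ‖B'‖ < R → ∃ U' : GaugeField (F.P P.K) 0 SU2,
          (∀ b, Ũ (cplxVec p, cplxVec B') b = ((U' b : SU2) : Matrix (Fin 2) (Fin 2) ℂ)) ∧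
            IsMinimizer (avOfRecord F 2 P.K) (regMSCoPOfRecord F 2 Θ.ν P.K (k P i) (maxDomT Θ.ν.M₁ (Z P i))) (Bj Θ.ν.M₁ (Z P i) (k P i))
              (avgFamily (avOfRecord F 2 P.K) (qsstarGIter0 (k P i) (expMul su2Chart B' (ext P i (expMul su2Chart p Vk))))) U')
    -- (L2) ONE-SIDED (1.7) p.358 for the Hessian of the slice function at `0`, γ₀-generic (dag-n12-w1's one-sided edition p589595 ∕ dag-n12-c g17 `h17`)
    (h17 : ∀ P i Vk, PlaqSmallOn (plaqsInside (pts (k P i) (Z P i ∩ (Λ P i)ᶜ))) (eR P i) Vk → ∀ X : GaugeSlice (pts (k P i) (Λ P i)) (T P i) E3,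
      γ₀ P * (∑ z ∈ box (fun κ => (hi P i κ - lo P i κ + 1).toNat + 3) (fun κ => lo P i κ - 2), ∑ μ : Fin (F.P P.K).d, ∑ a : Fin 3,
          curl (fun b => ιA (pts (k P i) (Λ P i)) (T P i) X (⟨castSite b.1, b.2⟩ : PBond (F.P P.K) (k P i)) a) z ⟨0, h0 P⟩ μ ^ 2) -
        Cerr P i * ‖X‖ ^ 2 ≤ ⟪X, (fderiv ℝ (rGrad (pts (k P i) (Λ P i)) (T P i)
              (sliceFn (pts (k P i) (Λ P i)) (T P i)
                (fun177std (bgMSCoPOfRecord F 2 Θ.ν P.K (k P i) (maxDomT Θ.ν.M₁ (Z P i))) Θ.ν.M₁ (Z P i) (k P i)) (ext P i Vk))) 0) X⟫)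
    (hsm : ∀ P i, Cerr P i ≤ γ₀ P / (2 * (3 * (Kb P i : ℝ) ^ 2 + 2 * (Kb P i : ℝ) ^ 4)))
    (hγle : ∀ P i, γ P / (M P i) ^ 5 ≤ γ₀ P / (2 * (3 * (Kb P i : ℝ) ^ 2 + 2 * (Kb P i : ℝ) ^ 4)))
    -- the geometric letter: every fine site whose k-block label lies in the box `[lo − 1, hi + 1]` lies in `Ω₁(Z)` (print: `Λ` deep inside `Z`); dag-n12-c's `far_letter_of_box` turns it into the bond letter `hfar`
    (hZ1 : ∀ P i (y : Site (F.P P.K) 0), B14.Eq22Determines.blockIter (k P i) y ∈ (castSite '' Set.Icc (lo P i - 1) (hi P i + 1) : Set (Site (F.P P.K) (k P i))) → y ∈ maxDomT Θ.ν.M₁ (Z P i) 1)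
    -- (Gᵃ) `Z` a union of `k`-blocks (print's `Z` is a union of `M`-cubes of `T₁^{(k)}`)
    (hZblk : ∀ P i, B14.Eq22Determines.IsBlockUnion (k P i) (Z P i))
    -- (Gᵇ) DISCHARGED (dag-n12-c §8): print's `M₁ ≥ 2` and, per instance, the torus divisibility `L^{k}·M₁ ∣ 2L^{m+K}` of the `LʲM₁`-cube partitions
    (hM2 : 2 ≤ Θ.ν.M₁) (hdiv : ∀ P i, B14.Eq213MaximalDomains.side (F.P P.K).L Θ.ν.M₁ (k P i) ∣ (F.P P.K).sitesPerDir 0)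
    -- bookkeeping constants: `c_E`, `c_A` per run; `B₃`, `a₀`, `a₁'` = THE [15] THEOREM-1 CONSTANTS OF (8) (one triple for all runs and instances)
    {cE cA : B12.RunParams → ℝ} {B₃ a₀ a₁' : ℝ} (hcE0 : ∀ P, 0 ≤ cE P) (hcE : ∀ P i, 12 * ((F.P P.K).d : ℝ) * ((n P i : ℝ) + 2) ^ 2 ≤ cE P) (hB₃ : 0 ≤ B₃)
    (heRa : ∀ P i, (cE P + 1) * eR P i ≤ a₁' ∧ B₃ * ((cE P + 1) * eR P i) ≤ Θ.ν.εreg) (ha₀ : Θ.ν.εreg ≤ a₀)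
    (hcA : ∀ P, 1 / 2 * (B₃ * (cE P + 1) * (F.P P.K).eta 1 ^ 2) ^ 2 * (Fintype.card (Plaq (F.P P.K) 0) : ℝ) ≤ cA P)
    -- [15] THEOREM 1 (R) = NODE 00's NAMED FACT (8) `VariationalThm1RegSepCoP7M` — K0⁷'s letter (plan g76 V15 stub 1's consequence by dag-n07-e's bridge) — ONE hypothesis for all runs and instances;
    -- §0 reads it at the degenerate history `(M, g) := (ν.M₁, 1)` as dag-n12-c's torus-class letter `h15T` at every `(Θ.ν, P.K)`
    (h15 : VariationalThm1RegSepCoP7M F 2 B₃ a₀ a₁') :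
    ∃ R areg : ∀ P : B12.RunParams, ι P → ℝ, (∀ P i, 0 < R P i) ∧ (∀ P i, 0 < areg P i) ∧
      ∀ P : B12.RunParams, lam.kSel P < P.K →
        B15Leaf (WOfRecord₁₃ F 2 (Θ.liveRepin₁₃ F 2)
          { lam with LF := fun P => lfVarOn su2Chart fun i => InstOn.std (bgMSCoPOfRecord F 2 Θ.ν P.K (k P i) (maxDomT Θ.ν.M₁ (Z P i))) Θ.ν.M₁ (Z P i) (Λ P i) (k P i) (M P i) (areg P i)
                            (anExt (pts (k P i) (Λ P i)) (T P i) (fun177std (bgMSCoPOfRecord F 2 Θ.ν P.K (k P i) (maxDomT Θ.ν.M₁ (Z P i))) Θ.ν.M₁ (Z P i) (k P i)) (ext P i)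
                              (min (1 / 2) (min (R P i / 8) (γ P / (M P i) ^ 5 * (R P i / 2) ^ 2 /
                                (48 * (4 * ((Fintype.card (Plaq (F.P P.K) 0) : ℝ) * (1 + 8 * 𝓐₀ P i ^ 4)) / R P i + 1)))))) } P) := by
  choose R hR areg ha hP using fun P : B12.RunParams =>
    exists_domain_prop1Printed_lfVarOn_std_su2_box_intrinsic_analytic_atZSeqCoPRecord_ofThm1TorusClass_ofMinimiserFamilyCompact_oneSided (F := F) Θ.ν P.K (hd3 P) (h0 P)
      (hcl := Subsingleton.elim _ _)
      (Z := Z P) (Λ := Λ P) (k := k P) (M := M P) (hk0 := hk0 P) (hk := hk P) (eR := eR P) (heR := heR P) (T := T P) (lo := lo P) (hi := hi P) (n := n P) (hn := hn P)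
      (hN := hN P) (hbox := hbox P) (hZ := hZ P) (hTG0 := hTG0 P) (hN5 := hN5 P) (K := Kb P) (hK1 := hK1 P) (hKn := hKn P) (ext := ext P) (hext := hext P) (hlohi := hlohi P)
      (hγ := hγ P) (hbx := hbx P) (hbxM := hbxM P) (hM := hM P) (hγ₀ := hγ₀ P) (hMinC := hMinC P) (h17 := h17 P)
      (hsm := hsm P) (hγle := hγle P) (hfar := fun i b hb => far_letter_of_box (hbox P i) (hZ1 P i) b hb) (hZblk := hZblk P) (hM2 := hM2) (hdiv := hdiv P)
      (hcE0 := hcE0 P) (hcE := hcE P) (hB₃ := hB₃) (heRa := heRa P) (ha₀ := ha₀) (hcA := hcA P)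
      (h15T := thm1TorusClass_of_variationalThm1RegSepCoP7M Θ.ν P.K h15)
  refine ⟨R, areg, hR, ha, fun P hkP => ?_⟩
  apply b15Leaf_WOfRecord₁₃_liveRepin₁₃_of_massLive_of_hasResiduals Θ _ hres (P := P)
  · exact hkP
  · exact hpin P hkP
  · exact hmassLive P hkP
  · exact hP P
  · exact h180 P hkP
  · exact h189 P hkP

end RecordAtZSeqCompact

/-! ## §2 At the GENERIC WINDOW-EDITION WITNESS `θ₁₅ᶜᶜᴹᵂ(j;γ;ε₀,ε₂₉;B₃,B₃',a₀,a₁)` of the V19 door: the [15] input IS the door letter `h15` -/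

section AtThm1CCMW
variable (j : ℕ) (γ ε₀ ε₂₉ B₃ B₃' a₀ a₁ : ℝ) (lam : ResidW F 2)

/-- **★★★★ THE SAME ROW AT THE GENERIC WINDOW-EDITION WITNESS `θ₁₅ᶜᶜᴹᵂ(j;γ;ε₀,ε₂₉;B₃,B₃',a₀,a₁)` OF THE V19 DOOR, THE [15] INPUT BEING THE DOOR LETTER `h15`** (§1 at
`Θ := theta13OfNumerics … (stage12NumericsOfThm1CCMW F.L j γ ε₀ B₃ B₃' a₀ a₁) …`, whose ₁₃ live re-pin IS `θ₁₅ᶜᶜᴹᵂ(j;γ;…)` by `rfl`; K0b's residuals by K0a's `hasResidualsOfRecord_theta13OfNumerics`;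
the window edition's Stage-7 numerics are the collared member's (`rfl`), so `2 ≤ M₁ = L^j` from `1 ≤ j` and `ν.εreg = a₀` by `rfl`): of dag-n24-c's fifteen door letters EXACTLY TWO are read —
`hB : 0 ≤ B₃` and `h15 : VariationalThm1RegSepCoP7M F 2 B₃ a₀ a₁` ((8), ⟸ stub 1 via dag-n07-e) —, whose `(B₃, a₀, a₁)` ARE the [15] constants of the bookkeeping (`heRa`, `hcA`); plus `1 ≤ j`.
What stays displayed per run ∕ instance: (J0′) `hMinC`, (L2) `h17` + `hsm` ∕ `hγle`, (Gᵃ), `hdiv`, `hZ1`, `hk0` ∕ `hk`, box data, `[Finite (ι P)]`, and N12's per-run displays below the torus.  The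
Proposition-1 conjunct of the companion file `…GenericDoorV19` §3's raw row `h12P1F` at this witness, with Prop. 1 PROVED from the w-lineage's letters.  Count-neutral; NOT a discharge of N12;
K0⁷ ∕ K1⁷ NOT closed. [cite: Balaban1989LargeFieldI, (0.2)–(0.6) p.176, (1.74) p.192, p.193 ll.14–20, Prop. 1 (1.77)–(1.78) p.194, (1.79)–(1.80) p.195, (1.89) p.198, (1.99)–(1.102) pp.200–201; Balaban1989LargeFieldII, (1.7)–(1.9) p.358, (1.11)–(1.13) p.359; Balaban1988Convergent, (2.1) p.254, (2.4)–(2.5) p.255, (2.12)–(2.14) pp.256–257, (3.16) p.268, (3.22)–(3.25) pp.269–270; Balaban1985RegularSpaces, (1.3)–(1.6) p.77 (witness letter); Balaban1985Variational, Thm 1 (8) p.279, Prop. 9 (190) p.309; Balaban1987RG1, Thm 1 p.259 (bookkeeping)] -/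
theorem exists_radius_pinLF_b15Leaf_WOfRecord₁₃_theta13OfThm1CCMW_of_massLive_of_variationalThm1RegSepCoP7M_atZSeqCoPRecord_compact (hj : 1 ≤ j)
    -- N12's displays at the letters `kSel ∕ D189 ∕ D1100` of `λ`, run by run, BELOW THE TORUS
    (hpin : ∀ P : B12.RunParams, lam.kSel P < P.K → lam.D1100 P
      = rPrimeDataOfSel (reprTOfRecord₁₃ F 2 (theta13OfThm1CCMW F 2 j γ ε₀ ε₂₉ B₃ B₃' a₀ a₁) P (lam.kSel P))
          ((theta13OfThm1CCMW F 2 j γ ε₀ ε₂₉ B₃ B₃' a₀ a₁).ppSel P (gOfRecord₁₃ F 2 (theta13OfThm1CCMW F 2 j γ ε₀ ε₂₉ B₃ B₃' a₀ a₁) P) (lam.kSel P + 1))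
          (fibOfSeq F (theta13OfThm1CCMW F 2 j γ ε₀ ε₂₉ B₃ B₃' a₀ a₁).ν (theta13OfThm1CCMW F 2 j γ ε₀ ε₂₉ B₃ B₃' a₀ a₁).τ9 P (gOfRecord₁₃ F 2 (theta13OfThm1CCMW F 2 j γ ε₀ ε₂₉ B₃ B₃' a₀ a₁) P) (lam.kSel P + 1)))
    (hmassLive : ∀ P : B12.RunParams, lam.kSel P < P.K → ∀ s, LiveSeq F 2 (theta13OfThm1CCMW F 2 j γ ε₀ ε₂₉ B₃ B₃' a₀ a₁).ν (theta13OfThm1CCMW F 2 j γ ε₀ ε₂₉ B₃ B₃' a₀ a₁).τ9 P (gOfRecord₁₃ F 2 (theta13OfThm1CCMW F 2 j γ ε₀ ε₂₉ B₃ B₃' a₀ a₁) P) (lam.kSel P + 1)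
        (slotsTOfRecord F 2 (theta13OfThm1CCMW F 2 j γ ε₀ ε₂₉ B₃ B₃' a₀ a₁).ν (theta13OfThm1CCMW F 2 j γ ε₀ ε₂₉ B₃ B₃' a₀ a₁).τ9 (EOfRecord₁₃ F 2 (theta13OfThm1CCMW F 2 j γ ε₀ ε₂₉ B₃ B₃' a₀ a₁)) (wOfRecord₉ F 2 (theta13OfThm1CCMW F 2 j γ ε₀ ε₂₉ B₃ B₃' a₀ a₁).toStage9Params)
          (theta13OfThm1CCMW F 2 j γ ε₀ ε₂₉ B₃ B₃' a₀ a₁).ppSel P (gOfRecord₁₃ F 2 (theta13OfThm1CCMW F 2 j γ ε₀ ε₂₉ B₃ B₃' a₀ a₁) P) (lam.kSel P + 1)) s →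
      0 < ∫ V, rterm (reprTOfRecord₁₃ F 2 (theta13OfThm1CCMW F 2 j γ ε₀ ε₂₉ B₃ B₃' a₀ a₁) P (lam.kSel P)) s V ∂(fieldMeasure (F.P P.K) (lam.kSel P + 1) (SU 2)))
    (h180 : ∀ P : B12.RunParams, lam.kSel P < P.K → ∀ U, new189 (lam.D189 P) U → ∀ i, (lam.D189 P).h ≤ i → i ≤ (lam.D189 P).k →
      ∀ q ∈ plaqsOf (dom (lam.D189 P) i),
        Ineq180 ((lam.D189 P).dev0 U q) ((lam.D189 P).ε (lam.D189 P).k) (lam.D189 P).η (lam.D189 P).B₃ (lam.D189 P).B₅ (lam.D189 P).M (lam.D189 P).δ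
          ((lam.D189 P).dist q) (lam.D189 P).O1)
    (h189 : ∀ P : B12.RunParams, lam.kSel P < P.K → Claim189 (new189 (lam.D189 P)) (chiPP (lam.D189 P)))
    -- dag-n12-c's Proposition-1 instance data ON THE RUN's LATTICE `F.P P.K`, per run `P` and instance `i : ι P` (structural ∕ constants, exactly as in its endpoint of record)
    (hd3 : ∀ P : B12.RunParams, 3 ≤ (F.P P.K).d) (h0 : ∀ P : B12.RunParams, 0 < (F.P P.K).d) (ι : B12.RunParams → Type)
    [hfin : ∀ P : B12.RunParams, Finite (ι P)]
    -- NO background letters: per instance the class is that of `Z P i`'s OWN maximal sequence `maxDomT (theta13OfThm1CCMW F 2 j γ ε₀ ε₂₉ B₃ B₃' a₀ a₁).ν.M₁ (Z P i)` up to scale `k P i` (dag-n12-c LOCATED-CLASS)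
    (Z Λ : ∀ P : B12.RunParams, ι P → Set (Site (F.P P.K) 0))
    (k : ∀ P : B12.RunParams, ι P → ℕ) (M : ∀ P : B12.RunParams, ι P → ℝ) (hk0 : ∀ P i, 0 < k P i) (hk : ∀ P i, k P i ≤ (F.P P.K).m + (F.P P.K).K)
    (eR : ∀ P : B12.RunParams, ι P → ℝ) (heR : ∀ P i, 0 < eR P i)
    (T : ∀ (P : B12.RunParams) (i : ι P), Finset (PBond (F.P P.K) (k P i)))
    (lo hi : ∀ P : B12.RunParams, ι P → Fin (F.P P.K).d → ℤ) (n : ∀ P : B12.RunParams, ι P → ℕ) (hn : ∀ P i κ, hi P i κ ≤ lo P i κ + n P i)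
    (hN : ∀ P i, n P i + 2 < (F.P P.K).sitesPerDir (k P i))
    (hbox : ∀ P i, pts (k P i) (Λ P i) = (castSite '' Set.Icc (lo P i) (hi P i) : Set (Site (F.P P.K) (k P i))))
    (hZ : ∀ P i, (boxPlaqs (lo P i - 1) (hi P i + 1) : Set (Plaq (F.P P.K) (k P i))) ⊆ plaqsInside (pts (k P i) (Z P i)))
    (hTG0 : ∀ P i, T P i = (box (fun κ => (hi P i κ - lo P i κ + 1).toNat) (lo P i)).image fun x =>
      (⟨castSite (x - unitVec ⟨0, h0 P⟩), ⟨0, h0 P⟩⟩ : PBond (F.P P.K) (k P i)))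
    (hN5 : ∀ P i κ, ((hi P i κ - lo P i κ + 1).toNat : ℤ) + 5 < (F.P P.K).sitesPerDir (k P i))
    (Kb : ∀ P : B12.RunParams, ι P → ℕ) (hK1 : ∀ P i, 1 ≤ Kb P i) (hKn : ∀ P i κ, (hi P i κ - lo P i κ + 1).toNat ≤ Kb P i)
    (ext : ∀ (P : B12.RunParams) (i : ι P), GaugeField (F.P P.K) (k P i) SU2 → GaugeField (F.P P.K) (k P i) SU2)
    (hext : ∀ P i Vk, ext P i Vk = extend (pts (k P i) (Λ P i)) (shellGauge Vk (lo P i) (hi P i)) Vk)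
    (hlohi : ∀ P i, lo P i ≤ hi P i)
    {γ₈ bx : B12.RunParams → ℝ} (hγ : ∀ P, 0 < γ₈ P) (hbx : ∀ P, 0 ≤ bx P)
    (hbxM : ∀ P i, 12 * ((F.P P.K).d : ℝ) * ((n P i : ℝ) + 2) ^ 2 ≤ bx P * (M P i) ^ 2)
    {Cerr 𝓐₀ : ∀ P : B12.RunParams, ι P → ℝ} (hM : ∀ P i, 1 ≤ M P i)
    {γ₀ : B12.RunParams → ℝ} (hγ₀ : ∀ P, 0 ≤ γ₀ P)
    -- (J0′) THE INTRINSIC CONFIGURATION LETTER IN THE COMPACTNESS ROUTE's OUTPUT SHAPE (dag-n12-c g17 §4 `hMinC`; produced by dag-n12-w1's `hMin_of_localCharts` ∕ `hMin_of_criticalFamilies`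
    -- lineage at `Kc :=` the closed guard): per run and instance, for EVERY COMPACT SET `Kc` of base fields inside the CLOSED small-field guard, ONE radius `R > 0` with the three clauses
    (hMinC : ∀ P i (Kc : Set (GaugeField (F.P P.K) (k P i) SU2)), IsCompact Kc →
      (∀ Vk ∈ Kc, ∀ p ∈ plaqsInside (pts (k P i) (Z P i ∩ (Λ P i)ᶜ)), dist1 (GaugeField.plaqHol Vk p) ≤ eR P i) →
      ∃ R : ℝ, 0 < R ∧ ∀ Vk ∈ Kc,
      ∃ Ũ : VecField (F.P P.K) (k P i) (EuclideanSpace ℂ (Fin 3)) × VecField (F.P P.K) (k P i) (EuclideanSpace ℂ (Fin 3)) →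
          PBond (F.P P.K) 0 → Matrix (Fin 2) (Fin 2) ℂ,
        (∀ b a c, DifferentiableOn ℂ (fun z => Ũ z b a c) (ball 0 R)) ∧
        (∀ z ∈ ball (0 : VecField (F.P P.K) (k P i) (EuclideanSpace ℂ (Fin 3)) × VecField (F.P P.K) (k P i) (EuclideanSpace ℂ (Fin 3))) R,
          ∀ b a c, ‖Ũ z b a c‖ ≤ 𝓐₀ P i) ∧
        ∀ p B' : VecField (F.P P.K) (k P i) E3, ‖p‖ < R → ‖B'‖ < R → ∃ U' : GaugeField (F.P P.K) 0 SU2,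
          (∀ b, Ũ (cplxVec p, cplxVec B') b = ((U' b : SU2) : Matrix (Fin 2) (Fin 2) ℂ)) ∧
            IsMinimizer (avOfRecord F 2 P.K) (regMSCoPOfRecord F 2 (theta13OfThm1CCMW F 2 j γ ε₀ ε₂₉ B₃ B₃' a₀ a₁).ν P.K (k P i) (maxDomT (theta13OfThm1CCMW F 2 j γ ε₀ ε₂₉ B₃ B₃' a₀ a₁).ν.M₁ (Z P i))) (Bj (theta13OfThm1CCMW F 2 j γ ε₀ ε₂₉ B₃ B₃' a₀ a₁).ν.M₁ (Z P i) (k P i))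
              (avgFamily (avOfRecord F 2 P.K) (qsstarGIter0 (k P i) (expMul su2Chart B' (ext P i (expMul su2Chart p Vk))))) U')
    -- (L2) ONE-SIDED (1.7) p.358 for the Hessian of the slice function at `0`, γ₀-generic (dag-n12-w1's one-sided edition p589595 ∕ dag-n12-c g17 `h17`)
    (h17 : ∀ P i Vk, PlaqSmallOn (plaqsInside (pts (k P i) (Z P i ∩ (Λ P i)ᶜ))) (eR P i) Vk → ∀ X : GaugeSlice (pts (k P i) (Λ P i)) (T P i) E3,
      γ₀ P * (∑ z ∈ box (fun κ => (hi P i κ - lo P i κ + 1).toNat + 3) (fun κ => lo P i κ - 2), ∑ μ : Fin (F.P P.K).d, ∑ a : Fin 3,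
          curl (fun b => ιA (pts (k P i) (Λ P i)) (T P i) X (⟨castSite b.1, b.2⟩ : PBond (F.P P.K) (k P i)) a) z ⟨0, h0 P⟩ μ ^ 2) -
        Cerr P i * ‖X‖ ^ 2 ≤ ⟪X, (fderiv ℝ (rGrad (pts (k P i) (Λ P i)) (T P i)
              (sliceFn (pts (k P i) (Λ P i)) (T P i)
                (fun177std (bgMSCoPOfRecord F 2 (theta13OfThm1CCMW F 2 j γ ε₀ ε₂₉ B₃ B₃' a₀ a₁).ν P.K (k P i) (maxDomT (theta13OfThm1CCMW F 2 j γ ε₀ ε₂₉ B₃ B₃' a₀ a₁).ν.M₁ (Z P i))) (theta13OfThm1CCMW F 2 j γ ε₀ ε₂₉ B₃ B₃' a₀ a₁).ν.M₁ (Z P i) (k P i)) (ext P i Vk))) 0) X⟫)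
    (hsm : ∀ P i, Cerr P i ≤ γ₀ P / (2 * (3 * (Kb P i : ℝ) ^ 2 + 2 * (Kb P i : ℝ) ^ 4)))
    (hγle : ∀ P i, γ₈ P / (M P i) ^ 5 ≤ γ₀ P / (2 * (3 * (Kb P i : ℝ) ^ 2 + 2 * (Kb P i : ℝ) ^ 4)))
    -- the geometric letter: every fine site whose k-block label lies in the box `[lo − 1, hi + 1]` lies in `Ω₁(Z)` (print: `Λ` deep inside `Z`); dag-n12-c's `far_letter_of_box` turns it into the bond letter `hfar`
    (hZ1 : ∀ P i (y : Site (F.P P.K) 0), B14.Eq22Determines.blockIter (k P i) y ∈ (castSite '' Set.Icc (lo P i - 1) (hi P i + 1) : Set (Site (F.P P.K) (k P i))) → y ∈ maxDomT (theta13OfThm1CCMW F 2 j γ ε₀ ε₂₉ B₃ B₃' a₀ a₁).ν.M₁ (Z P i) 1)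
    -- (Gᵃ) `Z` a union of `k`-blocks (print's `Z` is a union of `M`-cubes of `T₁^{(k)}`)
    (hZblk : ∀ P i, B14.Eq22Determines.IsBlockUnion (k P i) (Z P i))
    -- (Gᵇ) DISCHARGED (dag-n12-c §8): print's `M₁ ≥ 2` and, per instance, the torus divisibility `L^{k}·M₁ ∣ 2L^{m+K}` of the `LʲM₁`-cube partitions
    (hdiv : ∀ P i, B14.Eq213MaximalDomains.side (F.P P.K).L (theta13OfThm1CCMW F 2 j γ ε₀ ε₂₉ B₃ B₃' a₀ a₁).ν.M₁ (k P i) ∣ (F.P P.K).sitesPerDir 0)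
    -- bookkeeping constants: `c_E`, `c_A` per run; `B₃`, `a₀`, `a₁'` = THE [15] THEOREM-1 CONSTANTS OF (8) (one triple for all runs and instances)
    {cE cA : B12.RunParams → ℝ} (hcE0 : ∀ P, 0 ≤ cE P) (hcE : ∀ P i, 12 * ((F.P P.K).d : ℝ) * ((n P i : ℝ) + 2) ^ 2 ≤ cE P)
    (heRa : ∀ P i, (cE P + 1) * eR P i ≤ a₁ ∧ B₃ * ((cE P + 1) * eR P i) ≤ (theta13OfThm1CCMW F 2 j γ ε₀ ε₂₉ B₃ B₃' a₀ a₁).ν.εreg)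
    (hcA : ∀ P, 1 / 2 * (B₃ * (cE P + 1) * (F.P P.K).eta 1 ^ 2) ^ 2 * (Fintype.card (Plaq (F.P P.K) 0) : ℝ) ≤ cA P)
    -- TWO of dag-n24-c's V19 DOOR LETTERS: the sign `0 ≤ B₃` and [15] Thm 1's regularity sentence `h15` (⟸ K0⁷ stub 1's (8) top step, dag-n07-e) — its `(B₃, a₀, a₁)` ARE the [15]
    -- constants of the bookkeeping above (the witness's `εreg = a₀`, `rfl`); and the cube letter is POSITIVE, `1 ≤ j` (print's `M₁ = L^j ≥ 2`; the V19 cube letter is `j = ρ₀ + 3`)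
    (hB : 0 ≤ B₃) (h15 : VariationalThm1RegSepCoP7M F 2 B₃ a₀ a₁) :
    ∃ R areg : ∀ P : B12.RunParams, ι P → ℝ, (∀ P i, 0 < R P i) ∧ (∀ P i, 0 < areg P i) ∧
      ∀ P : B12.RunParams, lam.kSel P < P.K →
        B15Leaf (WOfRecord₁₃ F 2 (theta13OfThm1CCMW F 2 j γ ε₀ ε₂₉ B₃ B₃' a₀ a₁)
          { lam with LF := fun P => lfVarOn su2Chart fun i => InstOn.std (bgMSCoPOfRecord F 2 (theta13OfThm1CCMW F 2 j γ ε₀ ε₂₉ B₃ B₃' a₀ a₁).ν P.K (k P i) (maxDomT (theta13OfThm1CCMW F 2 j γ ε₀ ε₂₉ B₃ B₃' a₀ a₁).ν.M₁ (Z P i))) (theta13OfThm1CCMW F 2 j γ ε₀ ε₂₉ B₃ B₃' a₀ a₁).ν.M₁ (Z P i) (Λ P i) (k P i) (M P i) (areg P i)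
                            (anExt (pts (k P i) (Λ P i)) (T P i) (fun177std (bgMSCoPOfRecord F 2 (theta13OfThm1CCMW F 2 j γ ε₀ ε₂₉ B₃ B₃' a₀ a₁).ν P.K (k P i) (maxDomT (theta13OfThm1CCMW F 2 j γ ε₀ ε₂₉ B₃ B₃' a₀ a₁).ν.M₁ (Z P i))) (theta13OfThm1CCMW F 2 j γ ε₀ ε₂₉ B₃ B₃' a₀ a₁).ν.M₁ (Z P i) (k P i)) (ext P i)
                              (min (1 / 2) (min (R P i / 8) (γ₈ P / (M P i) ^ 5 * (R P i / 2) ^ 2 /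
                                (48 * (4 * ((Fintype.card (Plaq (F.P P.K) 0) : ℝ) * (1 + 8 * 𝓐₀ P i ^ 4)) / R P i + 1)))))) } P) := by
  -- `2 ≤ M₁ = L^j` at the window-edition witness (`1 ≤ j`, `1 < L`; `ν` is the collared member's, `rfl`); `εreg = a₀` (`rfl`)
  have h2 : 2 ≤ F.L ^ j :=
    calc 2 ≤ F.L := F.hL.2
      _ = F.L ^ 1 := (pow_one _).symm
      _ ≤ F.L ^ j := Nat.pow_le_pow_right (Nat.zero_lt_of_lt F.hL.2) hj
  exact exists_radius_pinLF_b15Leaf_WOfRecord₁₃_liveRepin₁₃_of_massLive_of_hasResiduals_of_variationalThm1RegSepCoP7M_atZSeqCoPRecord_compact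
    (theta13OfNumerics F 2 (stage12NumericsOfThm1CCMW F.L j γ ε₀ B₃ B₃' a₀ a₁) ε₂₉ (zeta316OfRecord F 2 (stage12NumericsOfThm1CCMW F.L j γ ε₀ B₃ B₃' a₀ a₁).ν (stage12NumericsOfThm1CCMW F.L j γ ε₀ B₃ B₃' a₀ a₁).τ9.M (stage12NumericsOfThm1CCMW F.L j γ ε₀ B₃ B₃' a₀ a₁).A₁) (RzOfRecord F 2) (ZtOfRecord F 2)) lam
    (hasResidualsOfRecord_theta13OfNumerics F 2 (stage12NumericsOfThm1CCMW F.L j γ ε₀ B₃ B₃' a₀ a₁) ε₂₉) (hM2 := h2) (hB₃ := hB) (ha₀ := le_of_eq rfl)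
    (h15 := h15)
    (hpin := hpin) (hmassLive := hmassLive) (h180 := h180) (h189 := h189) (hd3 := hd3) (h0 := h0) (ι := ι) (Z := Z) (Λ := Λ)
    (k := k) (M := M) (hk0 := hk0) (hk := hk) (eR := eR) (heR := heR) (T := T) (lo := lo) (hi := hi)
    (n := n) (hn := hn) (hN := hN) (hbox := hbox) (hZ := hZ) (hTG0 := hTG0) (hN5 := hN5) (Kb := Kb) (hK1 := hK1)
    (hKn := hKn) (ext := ext) (hext := hext) (hlohi := hlohi) (hγ := hγ) (hbx := hbx) (hbxM := hbxM) (hM := hM)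
    (hγ₀ := hγ₀) (hMinC := hMinC) (h17 := h17) (hsm := hsm) (hγle := hγle) (hZ1 := hZ1)
    (hZblk := hZblk) (hdiv := hdiv) (hcE0 := hcE0) (hcE := hcE) (heRa := heRa) (hcA := hcA)

end AtThm1CCMW

end Summit.QuantumFields.YangMills.BalabanUVNodes.N12AtRecord13Prop1KnitThm1CompactOfRecord
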